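import Summits.QuantumAdvantage.QuantumAdvantage.Theorems.SosSandwichTransferPBMachineEncodings
import HarnessLib

/-!
# Crux `TransferPB` (stmt-QuantumAdvantage-15238, route SosSandwich), line `birth` — the node-test thresholds and magnitudes are polynomially bounded

Support for the last obligation (Q) `nodeProblem F r c k ∈ PromiseBQP` of stub `stub_pbOracleSimulation`
(`Theorems/SosSandwichTransferPBMachineDefs.lean`, `…EventOSMFinal.lean`). A `PromiseBQP` machine for the
BLOCK / SINGLE / MEAN node tests estimates an acceptance probability by polynomially many parallel runs and
compares the count with an INSTANCE-DEPENDENT threshold (`Literature/…/PolyCopiesWindow.lean`,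
`PolyCopies.kernelProb_ge_of_gap`: error `1/(K(n)·gap²)`); the number of copies `K(n)` must therefore be a
polynomial dominating `1/gap²`. This file supplies the arithmetic of the gaps:

* `pbThreshold_eq` — the influence threshold in closed form, `w = 1/(2^k · (400 (r(n)+1) d)^c)` with
  `d = thm23Degree F x = 2T + 1` (`T` the number of oracle gates of `F.circ n`); `pbThreshold_le_one`;
  `pbThreshold_eq_of_length_eq` (it depends on the input only through its length);
* **`exists_poly_inv_le_pbThreshold`** — for a UNIFORM `F` there is a polynomial `q` with
  `1/(q(n)+1) ≤ w` on all inputs of length `n` (polynomial size bounds `T`), so the BLOCK/SINGLE gap `w/2` is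
  inverse-polynomial;
* `bbbvMag_le`, `blockMag_le` — the SINGLE and BLOCK node quantities lie in `[0, 4T²]` (BBBV's total query
  magnitude bound `sum_sum_queryWeights_le`: `Σ_y Σ_t q_y(|φ_t⟩) ≤ T`), the normalisation under which they become
  acceptance probabilities of a one-shot estimator; `nodeMean_mem` (in `[0,1]`) is already in
  `Theorems/SosSandwichTransferPBMachineSplit.lean`.

All proved; no definition, no named fact. Sources: S. Aaronson, A. Ambainis, Theory Comput. 10 (2014), proof
of Thm. 23 (p. 14); C. H. Bennett, E. Bernstein, G. Brassard, U. Vazirani, SIAM J. Comput. 26 (1997), Cor. 3.4;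
J. Watrous, Quantum computational complexity (2009), §IV.2 Prop. 3.
-/

-- D-0017: single-conjunct summit ⇒ the duplicate `QuantumAdvantage.QuantumAdvantage` is mandated.
set_option linter.dupNamespace false

noncomputable section

namespace Summit.QuantumAdvantage.QuantumAdvantage.Cruxes.TransferPB.Birth

open Finset Literature.Computability.Cryptography Literature.Computability.Complexity
  Literature.Computability.QuantumComplexity Literature.Computability.QuantumComplexity.ClassicalSimulation

namespace SimTreePB

section Threshold

variable (F : QCircuitFamily cliffordT) (x : List Bool) (r : Polynomial ℕ) (c k : ℕ)

/-- The degree parameter is positive: `d = 2T + 1 ≥ 1`. [cite: AaronsonAmbainis2014, Thm. 23 (proof, p. 14)] -/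
theorem thm23Degree_pos : 0 < thm23Degree F x := by
  unfold thm23Degree; omega

/-- **The influence threshold in closed form**: `w = 1 / (2^k · (400 · (r(n)+1) · d)^c)`, `d = thm23Degree F x`.
[cite: AaronsonAmbainis2014, Thm. 23 (proof, p. 14)] -/
theorem pbThreshold_eq :
    pbThreshold F x r c k =
      1 / ((2 : ℝ) ^ k * (400 * ((((r.eval x.length : ℕ) : ℝ) + 1) * (thm23Degree F x : ℝ))) ^ c) := by
  unfold pbThreshold
  have hd : (0 : ℝ) < thm23Degree F x := by exact_mod_cast thm23Degree_pos F x
  have hr : (0 : ℝ) < ((r.eval x.length : ℕ) : ℝ) + 1 := by positivity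
  have hinner : ((1 / 10 : ℝ) ^ 2 * (1 / (((r.eval x.length : ℕ) : ℝ) + 1)) / 2 / 2) / (thm23Degree F x : ℝ) =
      1 / (400 * ((((r.eval x.length : ℕ) : ℝ) + 1) * (thm23Degree F x : ℝ))) := by
    field_simp
    norm_num
  rw [hinner, one_div_pow, one_div_mul_one_div]

/-- The threshold is at most `1`. [cite: AaronsonAmbainis2014, Thm. 23 (proof, p. 14)] -/
theorem pbThreshold_le_one : pbThreshold F x r c k ≤ 1 := by
  rw [pbThreshold_eq]
  have hd : (1 : ℝ) ≤ thm23Degree F x := by exact_mod_cast thm23Degree_pos F x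
  have hr : (1 : ℝ) ≤ ((r.eval x.length : ℕ) : ℝ) + 1 := by
    have : (0 : ℝ) ≤ ((r.eval x.length : ℕ) : ℝ) := Nat.cast_nonneg _
    linarith
  have h1 : (1 : ℝ) ≤ 2 ^ k := one_le_pow₀ (by norm_num)
  have h2 : (1 : ℝ) ≤ (400 * ((((r.eval x.length : ℕ) : ℝ) + 1) * (thm23Degree F x : ℝ))) ^ c :=
    one_le_pow₀ (by nlinarith)
  rw [div_le_one (by positivity)]
  nlinarith

variable {x} in
/-- The threshold depends on the input only through its length. [cite: AaronsonAmbainis2014, Thm. 23 (proof, p. 14)] -/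
theorem pbThreshold_eq_of_length_eq {x' : List Bool} (h : x.length = x'.length) :
    pbThreshold F x r c k = pbThreshold F x' r c k := by
  unfold pbThreshold thm23Degree
  rw [h]

variable {F} in
/-- **The threshold is inverse-polynomial for a uniform family**: there is a polynomial `q` with
`1/(q(|x|)+1) ≤ w` for every input `x` (the number `T` of oracle gates of `F.circ n` is at most the size, which
is polynomial). Hence the BLOCK/SINGLE gaps `w − w/2` of `nodeProblem` are inverse-polynomial and polynomially
many parallel runs amplify them. [cite: Watrous2009, §IV.2 Prop. 3] -/
theorem exists_poly_inv_le_pbThreshold (hU : F.IsUniform) :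
    ∃ q : Polynomial ℕ, ∀ x : List Bool,
      1 / (((q.eval x.length : ℕ) : ℝ) + 1) ≤ pbThreshold F x r c k := by
  obtain ⟨p, hp⟩ := hU.isPolySize'
  refine ⟨Polynomial.C (2 ^ k) * (Polynomial.C 400 * (r + 1) * (2 * p + 1)) ^ c, fun x => ?_⟩
  have hT : (F.circ x.length).oracleQueries ≤ p.eval x.length :=
    (List.length_filter_le _ _).trans (hp x.length).1
  have hd : (thm23Degree F x : ℝ) ≤ 2 * ((p.eval x.length : ℕ) : ℝ) + 1 := by
    have : thm23Degree F x ≤ 2 * p.eval x.length + 1 := by unfold thm23Degree; omega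
    exact_mod_cast this
  have hdpos : (0 : ℝ) < thm23Degree F x := by exact_mod_cast thm23Degree_pos F x
  rw [pbThreshold_eq]
  have hq : (((Polynomial.C (2 ^ k) * (Polynomial.C 400 * (r + 1) * (2 * p + 1)) ^ c).eval x.length : ℕ) : ℝ) =
      (2 : ℝ) ^ k * (400 * ((((r.eval x.length : ℕ) : ℝ) + 1) * (2 * ((p.eval x.length : ℕ) : ℝ) + 1))) ^ c := by
    simp only [Polynomial.eval_mul, Polynomial.eval_pow, Polynomial.eval_add, Polynomial.eval_C,
      Polynomial.eval_one, Polynomial.eval_ofNat]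
    push_cast
    ring
  rw [hq]
  have hDpos : (0 : ℝ) < (2 : ℝ) ^ k * (400 * ((((r.eval x.length : ℕ) : ℝ) + 1) * (thm23Degree F x : ℝ))) ^ c := by
    positivity
  have hDQ : (2 : ℝ) ^ k * (400 * ((((r.eval x.length : ℕ) : ℝ) + 1) * (thm23Degree F x : ℝ))) ^ c ≤
      (2 : ℝ) ^ k * (400 * ((((r.eval x.length : ℕ) : ℝ) + 1) * (2 * ((p.eval x.length : ℕ) : ℝ) + 1))) ^ c := by
    gcongr
  exact one_div_le_one_div_of_le hDpos (by linarith)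

end Threshold

section Magnitudes

variable (F : QCircuitFamily cliffordT) (x : List Bool)

/-- **A SINGLE node quantity is at most `4T²`**: `m_s(ρ) = E_y[4T · Σ_t q_{σ(s)}(|φ_t⟩)] ≤ 4T · T`, by BBBV's
total query magnitude bound (`Σ_t q_y(|φ_t⟩) ≤ T` for a unit start vector).
[cite: BennettBernsteinBrassardVazirani1997, Cor. 3.4 (proof)] -/
theorem bbbvMag_le (ρ : List (Fin (numOracleBits F x) × Bool)) (s : Fin (numOracleBits F x)) :
    bbbvMag F x ρ s ≤ 4 * ((F.circ x.length).oracleQueries : ℝ) ^ 2 := by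
  unfold bbbvMag
  have hpt : ∀ y : Fin (numOracleBits F x) → Bool,
      4 * ((F.circ x.length).oracleQueries : ℝ) *
          (queryWeights (oracleOf F x (ρ.foldr (fun ib z => Function.update z ib.1 ib.2) y))
            ({((bitEquiv F x).symm s).1} : Set (List Bool)) (F.circ x.length).gates
            (basisState (padInput x.get (F.ancillas x.length)))).sum ≤
        4 * ((F.circ x.length).oracleQueries : ℝ) ^ 2 := by
    intro y
    have h := sum_sum_queryWeights_le cliffordT_isUnitary_holds
      (oracleOf F x (ρ.foldr (fun ib z => Function.update z ib.1 ib.2) y))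
      ({((bitEquiv F x).symm s).1} : Finset (List Bool)) (F.circ x.length).gates
      (basisState (padInput x.get (F.ancillas x.length)))
    rw [Finset.sum_singleton, normSq_basisState, mul_one] at h
    have hT : (0 : ℝ) ≤ 4 * ((F.circ x.length).oracleQueries : ℝ) := by positivity
    calc 4 * ((F.circ x.length).oracleQueries : ℝ) * _
        ≤ 4 * ((F.circ x.length).oracleQueries : ℝ) * ((F.circ x.length).oracleQueries : ℝ) :=
          mul_le_mul_of_nonneg_left h hT
      _ = 4 * ((F.circ x.length).oracleQueries : ℝ) ^ 2 := by ring
  calc boolAvg _ ≤ boolAvg (fun _ : Fin (numOracleBits F x) → Bool => 4 * ((F.circ x.length).oracleQueries : ℝ) ^ 2) := by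
        unfold boolAvg
        gcongr with y _
        exact hpt y
    _ = 4 * ((F.circ x.length).oracleQueries : ℝ) ^ 2 := boolAvg_const _

/-- **A BLOCK node quantity is at most `4T²`**: `M_u(ρ) = Σ_{s : u ⊑ σ(s)} m_s(ρ) ≤ E_y[4T · Σ_y Σ_t q_y] ≤ 4T²`
(distinct relevant bits name distinct strings, `bitString_injective`; BBBV's total query magnitude bound).
[cite: BennettBernsteinBrassardVazirani1997, Cor. 3.4 (proof)] -/
theorem blockMag_le (ρ : List (Fin (numOracleBits F x) × Bool)) (u : List Bool) :
    blockMag F x ρ u ≤ 4 * ((F.circ x.length).oracleQueries : ℝ) ^ 2 := by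
  classical
  have hT : (0 : ℝ) ≤ 4 * ((F.circ x.length).oracleQueries : ℝ) := by positivity
  -- pointwise in the completion `y`: the magnitudes of ALL relevant strings add up to at most `4T · T`
  have hpt : ∀ y : Fin (numOracleBits F x) → Bool,
      (∑ s : Fin (numOracleBits F x), 4 * ((F.circ x.length).oracleQueries : ℝ) *
          (queryWeights (oracleOf F x (ρ.foldr (fun ib z => Function.update z ib.1 ib.2) y))
            ({bitString F x s} : Set (List Bool)) (F.circ x.length).gates
            (basisState (padInput x.get (F.ancillas x.length)))).sum) ≤
        4 * ((F.circ x.length).oracleQueries : ℝ) ^ 2 := by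
    intro y
    rw [← Finset.mul_sum]
    have h := sum_sum_queryWeights_le cliffordT_isUnitary_holds
      (oracleOf F x (ρ.foldr (fun ib z => Function.update z ib.1 ib.2) y))
      (univ.image (bitString F x)) (F.circ x.length).gates
      (basisState (padInput x.get (F.ancillas x.length)))
    rw [Finset.sum_image fun a _ b _ hab => bitString_injective F x hab, normSq_basisState, mul_one] at h
    calc 4 * ((F.circ x.length).oracleQueries : ℝ) * _
        ≤ 4 * ((F.circ x.length).oracleQueries : ℝ) * ((F.circ x.length).oracleQueries : ℝ) :=
          mul_le_mul_of_nonneg_left h hT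
      _ = 4 * ((F.circ x.length).oracleQueries : ℝ) ^ 2 := by ring
  have hall : ∑ s : Fin (numOracleBits F x), bbbvMag F x ρ s ≤ 4 * ((F.circ x.length).oracleQueries : ℝ) ^ 2 := by
    have e : ∑ s : Fin (numOracleBits F x), bbbvMag F x ρ s =
        boolAvg (fun y : Fin (numOracleBits F x) → Bool => ∑ s : Fin (numOracleBits F x),
          4 * ((F.circ x.length).oracleQueries : ℝ) *
            (queryWeights (oracleOf F x (ρ.foldr (fun ib z => Function.update z ib.1 ib.2) y))
              ({bitString F x s} : Set (List Bool)) (F.circ x.length).gates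
              (basisState (padInput x.get (F.ancillas x.length)))).sum) := by
      simp only [bbbvMag, boolAvg, bitString]
      rw [← Finset.sum_div, Finset.sum_comm]
    rw [e]
    calc boolAvg _ ≤ boolAvg (fun _ : Fin (numOracleBits F x) → Bool => 4 * ((F.circ x.length).oracleQueries : ℝ) ^ 2) := by
          unfold boolAvg
          gcongr with y _
          exact hpt y
      _ = 4 * ((F.circ x.length).oracleQueries : ℝ) ^ 2 := boolAvg_const _
  unfold blockMag
  exact (Finset.sum_le_sum_of_subset_of_nonneg (Finset.filter_subset _ _)
    (fun s _ _ => bbbvMag_nonneg F x ρ s)).trans hall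

/-- The BLOCK node quantity is nonnegative. [folklore] -/
theorem blockMag_nonneg (ρ : List (Fin (numOracleBits F x) × Bool)) (u : List Bool) : 0 ≤ blockMag F x ρ u := by
  classical
  unfold blockMag
  exact Finset.sum_nonneg fun s _ => bbbvMag_nonneg F x ρ s

end Magnitudes

end SimTreePB

end Summit.QuantumAdvantage.QuantumAdvantage.Cruxes.TransferPB.Birth

end
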